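import Summits.QuantumFields.YangMills.Theorems.BalabanUVNodesN12AtRecord13OfResiduals
import Summits.QuantumFields.YangMills.Theorems.BalabanUVNodesN12AtRecord13TermPinned
import Literature.MathematicalPhysics.QuantumFieldTheory.Balaban1983to89.B15Claim189CubePin

/-!
# BalabanUVNodes ∕ N12 AT THE CUBE-PINNED TERM-PINNED STAGE-13 LAYERS ON THE LIVE LINE, FROM K0b's RESIDUALS ALONE — the [IV] leaf at `WOfRecord₁₃ (Θ.liveRepin₁₃) λᶜ P` with the (1.100)
# data pinned to Record 13's 𝐑-step, the (1.89) letters pinned to the term's situation along the ₁₃ history (dag-n12-e module 14) AND print's (1.88) cube data pinned to def-R's cube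
# partition (dag-n12-e module 15 `Sit189.pinCubes`): NO `Provisos₁₃`, NO row P11, NO (1.89) display, NO `hbox`, NO `hfib`, pin equation `rfl`, mass in the live form — generic and at the
# plan's `L`-keyed witness `θ₁₅ᶜ = theta13OfThm1C`
# (sequel of `…N12AtRecord13TermPinned` (14C) and `…N12AtRecord13OfResiduals` (12E); Track A, DAG node N12 = [B15, Balaban1989LargeFieldI] CMP **122** (1989) 175–202; cluster K1‴
# `StabilityBAtRecordR13e` = stmt-QuantumFields-19910 (rev 16); seat `pub-ymgap-dag-n12-d` g7 (R134 s2), 2026-08-27; count-neutral, NOT a discharge)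

HONEST FRAMING.  Count-neutral kernel BOOKKEEPING BY NAME over module 12E (`b15Leaf_WOfRecord₁₃_liveRepin₁₃_of_massLive_of_hasResiduals`: K0b's `HasResidualsOfRecord` + pin equation + live-mass +
Prop. 1 + (1.80) + (1.89) ⇒ the leaf; no proviso field) and dag-n12-e's module 15 `B15Claim189CubePin` (`Sit189.pinCubes σ S` — `Xhalf := {□ : □ ∩ S ≠ ∅}`, `boxOf p :=` the cube of a corner of
`p` in `S`, `S :=` the half domain `(Ω″^∼_{h+1})ᶜ ∩ Ω_h` of the term's chain; `claim189_sitOfHist_cubes_of_flow ∕ claim189_sitOfHist_cubes_N0Z_of_flow` = module 14's (1.89) display theorems with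
p29's located input `hbox` DISCHARGED as a lattice theorem, `0 < σ.sh`).  This file is 14C's live-re-pin layer RE-KEYED at both: `hP : Provisos₁₃ (Θ.liveRepin₁₃)` ↦ `hres : Θ.HasResidualsOfRecord`,
`σ` ↦ the cube-pinned situation family `P ↦ (σ P).pinCubes ((σ P).OmTᶜ ∩ Ω_{k′ − N}(s P))` (and `.pinDistAt k′`, v1.1), `hbox` (and `hdist`) gone.  Nothing of Bałaban's is asserted: (1.80) at the pinned `dev0`, the four ℍ-leaves
(1.90)–(1.97) ([B11] at the objects, N07), the shell bound `hgeom`, «We have j = k» `hZk` unless `Z″` is pinned, the residual numerics with print's second p.200 condition, the flow inputs, the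
live-mass display (NODE 00) and Prop. 1 (dag-n12-c) are DISPLAYED; N12 NOT discharged.  One finite four-torus programme at fixed `ε`; nothing continuum ∕ ℝ⁴ ∕ OS ∕ mass gap ∕ Clay.

* §1 GENERIC `Θ` CARRYING K0b's RESIDUALS, run with `kSel P < K`, `0 < (σ P).sh`, layer `λᶜ := (λ.pinRPrime₁₃ θL).pinD189TH θL.ν θL.A₁ θL.τ9.M (gOfRecord₁₃ θL) σᶜ s N N₀ p₁`, `θL := Θ.liveRepin₁₃`,
  `σᶜ P := (σ P).pinCubes ((σ P).OmTᶜ ∩ omegaOfChain (s P) (kSel P + 1 − N P))`: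
  ★ `b15Leaf_WOfRecord₁₃_pinAllTHCubes_liveRepin₁₃_of_massLive_of_hasResiduals_of_flow` (window-free; displayed: live-mass, Prop. 1, levels `2 ≤ N₀ P ≤ N P`, `N₀ P ≤ kSel P + 1`, residual
  numerics + print's two p.200 conditions, flow inputs `hε0 ∕ hε1 ∕ hflow`, `hZk`, `hgeom`, the four ℍ-leaves, (1.80));
  ★ `b15Leaf_WOfRecord₁₃_pinAllZHCubes_N0_liveRepin₁₃_of_massLive_of_hasResiduals_of_flow` (`Z″_j` pinned to the term's chain and `N₀ P := N0OfRecord₁₃ θL P (kSel P + 1)`: `hZk` AND `hbox`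
  discharged; `2 ≤ N₀` displayed at its source `1 < (log g⁻²)^r`);
  ★★ `b15Leaf_WOfRecord₁₃_pinAllGeom_N0_liveRepin₁₃_of_massLive_of_hasResiduals_of_flow` (module 15 v1.1: the (1.80) distance letter `dist(p, Λ)∕L^{k′}` of record pinned too — `hZk`, `hbox`
  AND `hdist` discharged; of the located geometry only the shell bound `hgeom` stays).
* §2 AT THE PLAN's `L`-KEYED WITNESS `θ₁₅ᶜ = theta13OfThm1C F N ε₀ ε₂₉ B₃ a₀ a₁` (node00-def-K0a FILE 11a; `θ₁₅ᶜ` IS the live re-pin of the all-numerics member at `stage12NumericsOfThm1C`, `rfl`;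
  K0b's residuals by K0a's `hasResidualsOfRecord_theta13OfNumerics`): `new189_pinAllTHCubes_theta13OfThm1C_one_zero` (NON-VACUITY at `(1,0)` on windowed runs, admissibility ⟸ the five
  witness signs by K0a's `admissible_theta13OfThm1C`) and ★★ `b15Leaf_WOfRecord₁₃_pinAllTHCubes_theta13OfThm1C_of_massLive_of_flow` — N12's row at `θ₁₅ᶜ`'s cube-pinned term-pinned bundle
  of record with ZERO K0‴-side hypotheses and NO (1.89) display; ★★★ `b15Leaf_WOfRecord₁₃_pinAllGeom_N0_theta13OfThm1C_of_massLive_of_flow` — the most-pinned form: its hypothesis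
  list IS the kernel's census of what N12 costs per run at the plan's witness.
WHAT N12 THEN COSTS PER RUN AT `θ₁₅ᶜ` (typing strength, NOT a second gap; kernel = the hypothesis list of §2): positive mass of the LIVE pre-𝐑 terms at level `kSel P + 1` (NODE 00); Prop. 1 at
`λ.LF P`; (1.80) + the four ℍ-leaves at the pinned letters ([B11]-at-objects, N07); the situation's residual numbers (`β, L₀, δ, B₃, B₅, O(1)`, `dist ≥ 0` — dag-n12-e INTENT-5 pins `dist`) with
print's two p.200 conditions; the shell bound `hgeom` and (TH form) `hZk`; per-run memory `N P ≥ N₀ P ≥ 2`; the flow inputs along the ₁₃ history; ONE TERM `s P` per run; for runs with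
`K ≤ kSel P` the leaf itself.  Nothing on the K0‴ side.  0 `sorry`, 0 `def`, standard axioms.  Filed `--supports` K1‴ (stmt-QuantumFields-19910) `--as helper`.
Sources: [Balaban1989LargeFieldI] (0.2)–(0.6) pp.176–177, Prop. 1 p.194, (1.80) p.195, (1.82) p.196, (1.88)–(1.90) pp.197–198, pp.199–201; [Balaban1988Convergent] (2.1) p.254, (2.8) p.256,
(2.17)–(2.18) p.257, (3.16)–(3.25) pp.268–270; [Balaban1989LargeFieldII] Thm 1 + (0.1) pp.355–356; [Balaban1985Variational] Thm 1 p.279 (witness letters only).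
-/

noncomputable section

open MeasureTheory
open scoped Matrix.Norms.L2Operator

namespace Summit.QuantumFields.YangMills.BalabanUVNodes.N12AtRecord13TermPinnedCubes

open Literature.MathematicalPhysics.QuantumFieldTheory.Balaban1983to89
open Literature.MathematicalPhysics.QuantumFieldTheory.Balaban1983to89.T4Continuum (T4Family)
open Literature.MathematicalPhysics.QuantumFieldTheory.Balaban1983to89.DagBinding (PrintedCarriers15 B15Leaf)
open Literature.MathematicalPhysics.QuantumFieldTheory.Balaban1983to89.Node00
open B15Claim189Assembly (Setting189 new189 chiPP dom half)
open B15 (Prop1Printed Ineq180)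
open B15.BasicStep (Claim189)
open B15.PrelimIntegrations (Ineq191 Ineq195)
open B15Chi124DetSets (E124)
open B15DeterminingSets (MSField)
open B14DomainGeom (Pt)
open B8Eq17ClassAkV1 (plaqsOf)
open GaugeGroup (dist1)
open GaugeField (plaqHol)
open B15Claim189PrintedConditions (omegaOfChain)
open B15Claim189PinsOfHistory (sitOfHist N0OfRecord₁₃ D189OfHist)
open B15Claim189CubePin (claim189_sitOfHist_cubes_of_flow claim189_sitOfHist_cubes_N0Z_of_flow claim189_sitOfHist_geom_N0Z_of_flow)
open Summit.QuantumFields.YangMills.BalabanUVNodes.N12AtRecord13OfResiduals (b15Leaf_WOfRecord₁₃_liveRepin₁₃_of_massLive_of_hasResiduals)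
open Summit.QuantumFields.YangMills.BalabanUVNodes.N12AtRecord13TermPinned (new189_pinAllTH_liveRepin₁₃_one_zero)

variable {N : ℕ} [NeZero N] {F : T4Family}

/-! ## §1 THE [IV] LEAF AT THE CUBE-PINNED TERM-PINNED LAYERS OF THE LIVE RE-PIN's BUNDLE OF RECORD, FROM K0b's RESIDUALS: (1.89) discharged, `hbox` gone, no proviso field -/

section Leaf
variable (Θ : Stage13Params F N) (lam : ResidW F N) (σ : ∀ P : B12.RunParams, Sit189 F N P.K)
  (s : ∀ P : B12.RunParams, SeqOfRecord F Θ.ν Θ.τ9.M (gOfRecord₁₃ F N (Θ.liveRepin₁₃ F N) P) P.K (lam.kSel P + 1)) (Nm N₀ : B12.RunParams → ℕ) (p₁ : ℕ)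

/-- **★ THE [IV] LEAF AT `WOfRecord₁₃ θL λᶜ P` (`θL := Θ.liveRepin₁₃`, `Θ` CARRYING K0b's RESIDUALS) FOR A RUN WITH `kSel P < K` — WINDOW-FREE, NO `Provisos₁₃`, NO (1.89) DISPLAY, NO `hbox`, NO `hfib`**:
12E's `b15Leaf_WOfRecord₁₃_liveRepin₁₃_of_massLive_of_hasResiduals` at the cube-pinned term-pinned layer `λᶜ` (pin equation `rfl`) with the `h189` slot SUPPLIED by dag-n12-e module 15's
`claim189_sitOfHist_cubes_of_flow` (`0 < (σ P).sh`).  Stated with a defining equation `hD` for the letters (instantiate `rfl`).  DISPLAYED: positive mass of the LIVE pre-𝐑 terms at level `kSel P + 1`,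
Prop. 1 at `λ.LF P`, the levels `2 ≤ N₀ P ≤ N P`, `N₀ P ≤ kSel P + 1`, the residual numerics and signs, print's two p.200 conditions (`hN₀ hMl`), the flow inputs along the ₁₃ history (`hε0 hε1 hflow`), the
located geometry (`hZk hgeom`), the four ℍ-leaves (`L91h L95 L91 L97`) and (1.80) (`L80`). [cite: Balaban1989LargeFieldI, (0.2)–(0.6) p.176, p.176 ll.14–16, Prop. 1 (1.78) p.194, (1.80) p.195, (1.88)–(1.90) pp.197–198, pp.199–201; Balaban1988Convergent, (2.1) p.254, (2.8) p.256, (2.17) p.257, (3.16) p.268, (3.22)–(3.25) pp.269–270] -/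
theorem b15Leaf_WOfRecord₁₃_pinAllTHCubes_liveRepin₁₃_of_massLive_of_hasResiduals_of_flow (hres : Θ.HasResidualsOfRecord F N) {P : B12.RunParams} (hK : lam.kSel P < P.K) (hsh : 0 < (σ P).sh)
    {D : Setting189 (F.P P.K) (SU N) (MSField (F.P P.K) (SU N) × ((j : ℕ) → VecField (F.P P.K) j (EuclideanSpace ℝ (Fin (N ^ 2 - 1))))) (Pt (F.P P.K).d)}
    (hD : D = ((lam.pinRPrime₁₃ (Θ.liveRepin₁₃ F N)).pinD189TH (Θ.liveRepin₁₃ F N).ν (Θ.liveRepin₁₃ F N).A₁ (Θ.liveRepin₁₃ F N).τ9.M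
      (gOfRecord₁₃ F N (Θ.liveRepin₁₃ F N))
        (fun P => (σ P).pinCubes ((σ P).OmTᶜ ∩ omegaOfChain (s P) (lam.kSel P + 1 - Nm P))) s Nm N₀ p₁).D189 P)
    (hmassLive : ∀ a, LiveSeq F N Θ.ν Θ.τ9 P (gOfRecord₁₃ F N (Θ.liveRepin₁₃ F N) P) (lam.kSel P + 1)
        (slotsTOfRecord F N Θ.ν Θ.τ9 (EOfRecord₁₃ F N (Θ.liveRepin₁₃ F N)) (wOfRecord₉ F N (Θ.liveRepin₁₃ F N).toStage9Params)
          (Θ.liveRepin₁₃ F N).ppSel P (gOfRecord₁₃ F N (Θ.liveRepin₁₃ F N) P) (lam.kSel P + 1)) a →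
      0 < ∫ V, rterm (reprTOfRecord₁₃ F N (Θ.liveRepin₁₃ F N) P (lam.kSel P)) a V ∂(fieldMeasure (F.P P.K) (lam.kSel P + 1) (SU N)))
    (hP1 : Prop1Printed (lam.LF P))
    -- levels, residual numerics, print's two conditions (p. 200)
    (hN2 : 2 ≤ N₀ P) (hNN : N₀ P ≤ Nm P) (hNk : N₀ P ≤ lam.kSel P + 1)
    (hβ0 : 0 ≤ (σ P).β) (hβ : (σ P).β ≤ 1 / 4) (hL₀ : 2 ≤ (σ P).L₀) (hL₀L : (σ P).L₀ ^ 2 ≤ ((F.P P.K).L : ℝ))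
    (hB : 0 ≤ (σ P).O1 * (σ P).B₃ * (σ P).B₅) (hδ : 0 ≤ (σ P).δ) (hdist : ∀ p, 0 ≤ (σ P).dist p)
    (hN₀ : (2 + (121 / 120) ^ 2 * ((σ P).O1 * (σ P).B₃ * (σ P).B₅ * (Θ.τ9.M : ℝ) ^ 5)) * ((((σ P).L₀ ^ 2) ^ (N₀ P - 1))⁻¹) ≤ 1 / 4)
    (hMl : (121 / 120) ^ 2 * ((σ P).O1 * (σ P).B₃ * (σ P).B₅ * (Θ.τ9.M : ℝ) ^ 5) * Real.exp (-(4 * (σ P).δ * (Θ.τ9.M : ℝ))) ≤ 1 / 12)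
    -- the flow inputs along the Stage-13 history (window-free)
    (hε0 : ∀ i, lam.kSel P + 1 - Nm P ≤ i → i ≤ lam.kSel P + 1 → 0 ≤ epsOfRecord Θ.ν (gOfRecord₁₃ F N (Θ.liveRepin₁₃ F N) P) i)
    (hε1 : ∀ i, lam.kSel P + 1 - Nm P ≤ i → i ≤ lam.kSel P + 1 → epsOfRecord Θ.ν (gOfRecord₁₃ F N (Θ.liveRepin₁₃ F N) P) i ≤ 1 / 10)
    {β₀ : ℝ} (hβ₀0 : 0 ≤ β₀) (hβ₀ : β₀ ≤ 1 / 2)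
    (hflow : ∀ j, lam.kSel P + 1 - Nm P ≤ j → j < lam.kSel P + 1 → epsOfRecord Θ.ν (gOfRecord₁₃ F N (Θ.liveRepin₁₃ F N) P) (lam.kSel P + 1)
      ≤ (1 + β₀) * Real.sqrt ((lam.kSel P + 1 - j : ℕ) : ℝ) * epsOfRecord Θ.ν (gOfRecord₁₃ F N (Θ.liveRepin₁₃ F N) P) j)
    -- located geometry
    (hZk : ∀ m, lam.kSel P + 1 - N₀ P < m → m < lam.kSel P + 1 → (σ P).Zpp (lam.kSel P + 1) ∩ omegaOfChain (s P) m ⊆ omegaOfChain (s P) (m + 1))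
    (hgeom : ∀ m, D.k₀ < m → m < D.k → ∀ p ∈ plaqsOf (D.Ω m \ D.Ω (m + 1)), 4 * ((m : ℝ) - D.k₀) * D.M ≤ D.dist p)
    -- the four ℍ-leaves and (1.80)
    (L91h : ∀ U, new189 D U → ∀ p ∈ plaqsOf (half D),
      Ineq191 (dist1 (plaqHol (D.Upp U) p)) (D.devV'' U p) D.α ((D.L ^ D.h)⁻¹) (D.ε D.h) (E124 D.ε D.L D.η D.k D.h))
    (L95 : ∀ U, new189 D U → ∀ p ∈ plaqsOf (half D),
      Ineq195 (D.devV'' U p) (dist1 (plaqHol (D.Uhalf U (D.boxOf p)) p)) D.α ((D.L ^ D.h)⁻¹) (D.ε D.h) (E124 D.ε D.L D.η D.k D.h))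
    (L91 : ∀ U, new189 D U → ∀ j, D.h ≤ j → j ≤ D.k → ∀ p ∈ plaqsOf (dom D j),
      Ineq191 (dist1 (plaqHol (D.Upp U) p)) (D.dev97 U p) D.α ((D.L ^ j)⁻¹) (D.ε j) (E124 D.ε D.L D.η D.k j))
    (L97 : ∀ U, new189 D U → ∀ j, D.h ≤ j → j ≤ D.k → ∀ p ∈ plaqsOf (dom D j),
      Ineq191 (D.dev97 U p) (D.dev0 U p) D.α ((D.L ^ j)⁻¹) (D.ε j) (E124 D.ε D.L D.η D.k j))
    (L80 : ∀ U, new189 D U → ∀ j, D.h ≤ j → j ≤ D.k → ∀ p ∈ plaqsOf (dom D j),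
      Ineq180 (D.dev0 U p) (D.ε D.k) D.η D.B₃ D.B₅ D.M D.δ (D.dist p) D.O1) :
    B15Leaf (WOfRecord₁₃ F N (Θ.liveRepin₁₃ F N)
      ((lam.pinRPrime₁₃ (Θ.liveRepin₁₃ F N)).pinD189TH (Θ.liveRepin₁₃ F N).ν (Θ.liveRepin₁₃ F N).A₁ (Θ.liveRepin₁₃ F N).τ9.M
        (gOfRecord₁₃ F N (Θ.liveRepin₁₃ F N))
        (fun P => (σ P).pinCubes ((σ P).OmTᶜ ∩ omegaOfChain (s P) (lam.kSel P + 1 - Nm P))) s Nm N₀ p₁) P) := by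
  subst hD
  exact b15Leaf_WOfRecord₁₃_liveRepin₁₃_of_massLive_of_hasResiduals Θ _ hres hK rfl hmassLive hP1 (fun U hU i hi hik q hq => L80 U hU i hi hik q hq)
    (claim189_sitOfHist_cubes_of_flow (Nm P) P (σ P) (s P) (N₀ P) p₁ hsh rfl hN2 hNN hNk hβ0 hβ hL₀ hL₀L hB hδ hdist hN₀ hMl hε0 hε1 hβ₀0 hβ₀ hflow hZk hgeom L91h L95 L91 L97 L80)

/-- **★ THE SAME WITH PRINT's `Z″_j` PINNED TO THE TERM's CHAIN AND `N₀ P := N₀ OF RECORD 13`, WINDOW-FREE** (module 15's `claim189_sitOfHist_cubes_N0Z_of_flow` at the layer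
`λᶻᶜ := (λ.pinRPrime₁₃ θL).pinD189ZH … σᶜ s N (N0OfRecord₁₃ θL · (kSel · + 1)) enl p₁`, enlargement inflationary): the located inputs «We have j = k» (`hZk`) AND `hbox` are BOTH DISCHARGED; of the
located geometry only the shell bound `hgeom` stays; `2 ≤ N₀` displayed at its source `1 < (log g⁻²)^r`, print's first condition as `hN₀`; NO `Provisos₁₃`. [cite: Balaban1989LargeFieldI, (0.2)–(0.6) p.176, Prop. 1 (1.78) p.194, (1.80) p.195, (1.10)–(1.11) p.179, (1.88)–(1.90) pp.197–198, pp.199–201; Balaban1988Convergent, (2.1) p.254, (2.5)–(2.8) pp.255–256, (2.17) p.257, (3.16) p.268] -/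
theorem b15Leaf_WOfRecord₁₃_pinAllZHCubes_N0_liveRepin₁₃_of_massLive_of_hasResiduals_of_flow (hres : Θ.HasResidualsOfRecord F N)
    (enl : ∀ P : B12.RunParams, ℕ → ℕ → Set (Site (F.P P.K) 0) → Set (Site (F.P P.K) 0)) {P : B12.RunParams} (hK : lam.kSel P < P.K) (hsh : 0 < (σ P).sh)
    (henl : ∀ n j (S : Set (Site (F.P P.K) 0)), S ⊆ enl P n j S)
    {D : Setting189 (F.P P.K) (SU N) (MSField (F.P P.K) (SU N) × ((j : ℕ) → VecField (F.P P.K) j (EuclideanSpace ℝ (Fin (N ^ 2 - 1))))) (Pt (F.P P.K).d)}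
    (hD : D = ((lam.pinRPrime₁₃ (Θ.liveRepin₁₃ F N)).pinD189ZH (Θ.liveRepin₁₃ F N).ν (Θ.liveRepin₁₃ F N).A₁ (Θ.liveRepin₁₃ F N).τ9.M
      (gOfRecord₁₃ F N (Θ.liveRepin₁₃ F N))
        (fun P => (σ P).pinCubes ((σ P).OmTᶜ ∩ omegaOfChain (s P) (lam.kSel P + 1 - Nm P))) s Nm (fun P => N0OfRecord₁₃ (Θ.liveRepin₁₃ F N) P (lam.kSel P + 1)) enl p₁).D189 P)
    (hmassLive : ∀ a, LiveSeq F N Θ.ν Θ.τ9 P (gOfRecord₁₃ F N (Θ.liveRepin₁₃ F N) P) (lam.kSel P + 1)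
        (slotsTOfRecord F N Θ.ν Θ.τ9 (EOfRecord₁₃ F N (Θ.liveRepin₁₃ F N)) (wOfRecord₉ F N (Θ.liveRepin₁₃ F N).toStage9Params)
          (Θ.liveRepin₁₃ F N).ppSel P (gOfRecord₁₃ F N (Θ.liveRepin₁₃ F N) P) (lam.kSel P + 1)) a →
      0 < ∫ V, rterm (reprTOfRecord₁₃ F N (Θ.liveRepin₁₃ F N) P (lam.kSel P)) a V ∂(fieldMeasure (F.P P.K) (lam.kSel P + 1) (SU N)))
    (hP1 : Prop1Printed (lam.LF P))
    (hlog : 1 < (Real.log (gOfRecord₁₃ F N (Θ.liveRepin₁₃ F N) P (lam.kSel P + 1) ^ 2)⁻¹) ^ Θ.ν.r)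
    (hNN : N0OfRecord₁₃ (Θ.liveRepin₁₃ F N) P (lam.kSel P + 1) ≤ Nm P) (hNk : N0OfRecord₁₃ (Θ.liveRepin₁₃ F N) P (lam.kSel P + 1) ≤ lam.kSel P + 1)
    (hβ0 : 0 ≤ (σ P).β) (hβ : (σ P).β ≤ 1 / 4) (hL₀ : 2 ≤ (σ P).L₀) (hL₀L : (σ P).L₀ ^ 2 ≤ ((F.P P.K).L : ℝ))
    (hB : 0 ≤ (σ P).O1 * (σ P).B₃ * (σ P).B₅) (hδ : 0 ≤ (σ P).δ) (hdist : ∀ p, 0 ≤ (σ P).dist p)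
    (hN₀ : (2 + (121 / 120) ^ 2 * ((σ P).O1 * (σ P).B₃ * (σ P).B₅ * (Θ.τ9.M : ℝ) ^ 5)) *
      ((((σ P).L₀ ^ 2) ^ (N0OfRecord₁₃ (Θ.liveRepin₁₃ F N) P (lam.kSel P + 1) - 1))⁻¹) ≤ 1 / 4)
    (hMl : (121 / 120) ^ 2 * ((σ P).O1 * (σ P).B₃ * (σ P).B₅ * (Θ.τ9.M : ℝ) ^ 5) * Real.exp (-(4 * (σ P).δ * (Θ.τ9.M : ℝ))) ≤ 1 / 12)
    (hε0 : ∀ i, lam.kSel P + 1 - Nm P ≤ i → i ≤ lam.kSel P + 1 → 0 ≤ epsOfRecord Θ.ν (gOfRecord₁₃ F N (Θ.liveRepin₁₃ F N) P) i)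
    (hε1 : ∀ i, lam.kSel P + 1 - Nm P ≤ i → i ≤ lam.kSel P + 1 → epsOfRecord Θ.ν (gOfRecord₁₃ F N (Θ.liveRepin₁₃ F N) P) i ≤ 1 / 10)
    {β₀ : ℝ} (hβ₀0 : 0 ≤ β₀) (hβ₀ : β₀ ≤ 1 / 2)
    (hflow : ∀ j, lam.kSel P + 1 - Nm P ≤ j → j < lam.kSel P + 1 → epsOfRecord Θ.ν (gOfRecord₁₃ F N (Θ.liveRepin₁₃ F N) P) (lam.kSel P + 1)
      ≤ (1 + β₀) * Real.sqrt ((lam.kSel P + 1 - j : ℕ) : ℝ) * epsOfRecord Θ.ν (gOfRecord₁₃ F N (Θ.liveRepin₁₃ F N) P) j)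
    (hgeom : ∀ m, D.k₀ < m → m < D.k → ∀ p ∈ plaqsOf (D.Ω m \ D.Ω (m + 1)), 4 * ((m : ℝ) - D.k₀) * D.M ≤ D.dist p)
    (L91h : ∀ U, new189 D U → ∀ p ∈ plaqsOf (half D),
      Ineq191 (dist1 (plaqHol (D.Upp U) p)) (D.devV'' U p) D.α ((D.L ^ D.h)⁻¹) (D.ε D.h) (E124 D.ε D.L D.η D.k D.h))
    (L95 : ∀ U, new189 D U → ∀ p ∈ plaqsOf (half D),
      Ineq195 (D.devV'' U p) (dist1 (plaqHol (D.Uhalf U (D.boxOf p)) p)) D.α ((D.L ^ D.h)⁻¹) (D.ε D.h) (E124 D.ε D.L D.η D.k D.h))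
    (L91 : ∀ U, new189 D U → ∀ j, D.h ≤ j → j ≤ D.k → ∀ p ∈ plaqsOf (dom D j),
      Ineq191 (dist1 (plaqHol (D.Upp U) p)) (D.dev97 U p) D.α ((D.L ^ j)⁻¹) (D.ε j) (E124 D.ε D.L D.η D.k j))
    (L97 : ∀ U, new189 D U → ∀ j, D.h ≤ j → j ≤ D.k → ∀ p ∈ plaqsOf (dom D j),
      Ineq191 (D.dev97 U p) (D.dev0 U p) D.α ((D.L ^ j)⁻¹) (D.ε j) (E124 D.ε D.L D.η D.k j))
    (L80 : ∀ U, new189 D U → ∀ j, D.h ≤ j → j ≤ D.k → ∀ p ∈ plaqsOf (dom D j),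
      Ineq180 (D.dev0 U p) (D.ε D.k) D.η D.B₃ D.B₅ D.M D.δ (D.dist p) D.O1) :
    B15Leaf (WOfRecord₁₃ F N (Θ.liveRepin₁₃ F N)
      ((lam.pinRPrime₁₃ (Θ.liveRepin₁₃ F N)).pinD189ZH (Θ.liveRepin₁₃ F N).ν (Θ.liveRepin₁₃ F N).A₁ (Θ.liveRepin₁₃ F N).τ9.M
        (gOfRecord₁₃ F N (Θ.liveRepin₁₃ F N))
        (fun P => (σ P).pinCubes ((σ P).OmTᶜ ∩ omegaOfChain (s P) (lam.kSel P + 1 - Nm P))) s Nm (fun P => N0OfRecord₁₃ (Θ.liveRepin₁₃ F N) P (lam.kSel P + 1)) enl p₁) P) := by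
  subst hD
  exact b15Leaf_WOfRecord₁₃_liveRepin₁₃_of_massLive_of_hasResiduals Θ _ hres hK rfl hmassLive hP1 (fun U hU i hi hik q hq => L80 U hU i hi hik q hq)
    (claim189_sitOfHist_cubes_N0Z_of_flow (Nm P) P (σ P) (s P) p₁ hsh (enl P) henl rfl hlog hNN hNk hβ0 hβ hL₀ hL₀L hB hδ hdist hN₀ hMl hε0 hε1 hβ₀0 hβ₀ hflow
      hgeom L91h L95 L91 L97 L80)


/-- **★★ THE SAME WITH THE (1.80) DISTANCE LETTER ALSO PINNED — `hZk`, `hbox` AND `hdist` ALL DISCHARGED** (module 15 v1.1's `claim189_sitOfHist_geom_N0Z_of_flow` at the layer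
`λᵍ := (λ.pinRPrime₁₃ θL).pinD189ZH … σᵍ s N (N0OfRecord₁₃ θL · (kSel · + 1)) enl p₁`, `σᵍ P := ((σ P).pinCubes (…)).pinDistAt (kSel P + 1)` — `dist p := dist(p, Λ)∕L^{k′}` of record): of the located
geometry ONLY the shell bound `hgeom` remains, now a statement about objects of record (the term's chain, the letter `Λ`); NO `Provisos₁₃`, NO (1.89) display. [cite: Balaban1989LargeFieldI, (0.2)–(0.6) p.176, Prop. 1 (1.78) p.194, (1.80) p.195, (1.10)–(1.11) p.179, (1.88)–(1.90) pp.197–198, pp.199–201; Balaban1988Convergent, (2.1) p.254, (2.5)–(2.8) pp.255–256, (2.17) p.257, (3.16) p.268] -/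
theorem b15Leaf_WOfRecord₁₃_pinAllGeom_N0_liveRepin₁₃_of_massLive_of_hasResiduals_of_flow (hres : Θ.HasResidualsOfRecord F N)
    (enl : ∀ P : B12.RunParams, ℕ → ℕ → Set (Site (F.P P.K) 0) → Set (Site (F.P P.K) 0)) {P : B12.RunParams} (hK : lam.kSel P < P.K) (hsh : 0 < (σ P).sh)
    (henl : ∀ n j (S : Set (Site (F.P P.K) 0)), S ⊆ enl P n j S)
    {D : Setting189 (F.P P.K) (SU N) (MSField (F.P P.K) (SU N) × ((j : ℕ) → VecField (F.P P.K) j (EuclideanSpace ℝ (Fin (N ^ 2 - 1))))) (Pt (F.P P.K).d)}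
    (hD : D = ((lam.pinRPrime₁₃ (Θ.liveRepin₁₃ F N)).pinD189ZH (Θ.liveRepin₁₃ F N).ν (Θ.liveRepin₁₃ F N).A₁ (Θ.liveRepin₁₃ F N).τ9.M
      (gOfRecord₁₃ F N (Θ.liveRepin₁₃ F N))
        (fun P => ((σ P).pinCubes ((σ P).OmTᶜ ∩ omegaOfChain (s P) (lam.kSel P + 1 - Nm P))).pinDistAt (lam.kSel P + 1)) s Nm (fun P => N0OfRecord₁₃ (Θ.liveRepin₁₃ F N) P (lam.kSel P + 1)) enl p₁).D189 P)
    (hmassLive : ∀ a, LiveSeq F N Θ.ν Θ.τ9 P (gOfRecord₁₃ F N (Θ.liveRepin₁₃ F N) P) (lam.kSel P + 1)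
        (slotsTOfRecord F N Θ.ν Θ.τ9 (EOfRecord₁₃ F N (Θ.liveRepin₁₃ F N)) (wOfRecord₉ F N (Θ.liveRepin₁₃ F N).toStage9Params)
          (Θ.liveRepin₁₃ F N).ppSel P (gOfRecord₁₃ F N (Θ.liveRepin₁₃ F N) P) (lam.kSel P + 1)) a →
      0 < ∫ V, rterm (reprTOfRecord₁₃ F N (Θ.liveRepin₁₃ F N) P (lam.kSel P)) a V ∂(fieldMeasure (F.P P.K) (lam.kSel P + 1) (SU N)))
    (hP1 : Prop1Printed (lam.LF P))
    (hlog : 1 < (Real.log (gOfRecord₁₃ F N (Θ.liveRepin₁₃ F N) P (lam.kSel P + 1) ^ 2)⁻¹) ^ Θ.ν.r)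
    (hNN : N0OfRecord₁₃ (Θ.liveRepin₁₃ F N) P (lam.kSel P + 1) ≤ Nm P) (hNk : N0OfRecord₁₃ (Θ.liveRepin₁₃ F N) P (lam.kSel P + 1) ≤ lam.kSel P + 1)
    (hβ0 : 0 ≤ (σ P).β) (hβ : (σ P).β ≤ 1 / 4) (hL₀ : 2 ≤ (σ P).L₀) (hL₀L : (σ P).L₀ ^ 2 ≤ ((F.P P.K).L : ℝ))
    (hB : 0 ≤ (σ P).O1 * (σ P).B₃ * (σ P).B₅) (hδ : 0 ≤ (σ P).δ)
    (hN₀ : (2 + (121 / 120) ^ 2 * ((σ P).O1 * (σ P).B₃ * (σ P).B₅ * (Θ.τ9.M : ℝ) ^ 5)) *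
      ((((σ P).L₀ ^ 2) ^ (N0OfRecord₁₃ (Θ.liveRepin₁₃ F N) P (lam.kSel P + 1) - 1))⁻¹) ≤ 1 / 4)
    (hMl : (121 / 120) ^ 2 * ((σ P).O1 * (σ P).B₃ * (σ P).B₅ * (Θ.τ9.M : ℝ) ^ 5) * Real.exp (-(4 * (σ P).δ * (Θ.τ9.M : ℝ))) ≤ 1 / 12)
    (hε0 : ∀ i, lam.kSel P + 1 - Nm P ≤ i → i ≤ lam.kSel P + 1 → 0 ≤ epsOfRecord Θ.ν (gOfRecord₁₃ F N (Θ.liveRepin₁₃ F N) P) i)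
    (hε1 : ∀ i, lam.kSel P + 1 - Nm P ≤ i → i ≤ lam.kSel P + 1 → epsOfRecord Θ.ν (gOfRecord₁₃ F N (Θ.liveRepin₁₃ F N) P) i ≤ 1 / 10)
    {β₀ : ℝ} (hβ₀0 : 0 ≤ β₀) (hβ₀ : β₀ ≤ 1 / 2)
    (hflow : ∀ j, lam.kSel P + 1 - Nm P ≤ j → j < lam.kSel P + 1 → epsOfRecord Θ.ν (gOfRecord₁₃ F N (Θ.liveRepin₁₃ F N) P) (lam.kSel P + 1)
      ≤ (1 + β₀) * Real.sqrt ((lam.kSel P + 1 - j : ℕ) : ℝ) * epsOfRecord Θ.ν (gOfRecord₁₃ F N (Θ.liveRepin₁₃ F N) P) j)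
    (hgeom : ∀ m, D.k₀ < m → m < D.k → ∀ p ∈ plaqsOf (D.Ω m \ D.Ω (m + 1)), 4 * ((m : ℝ) - D.k₀) * D.M ≤ D.dist p)
    (L91h : ∀ U, new189 D U → ∀ p ∈ plaqsOf (half D),
      Ineq191 (dist1 (plaqHol (D.Upp U) p)) (D.devV'' U p) D.α ((D.L ^ D.h)⁻¹) (D.ε D.h) (E124 D.ε D.L D.η D.k D.h))
    (L95 : ∀ U, new189 D U → ∀ p ∈ plaqsOf (half D),
      Ineq195 (D.devV'' U p) (dist1 (plaqHol (D.Uhalf U (D.boxOf p)) p)) D.α ((D.L ^ D.h)⁻¹) (D.ε D.h) (E124 D.ε D.L D.η D.k D.h))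
    (L91 : ∀ U, new189 D U → ∀ j, D.h ≤ j → j ≤ D.k → ∀ p ∈ plaqsOf (dom D j),
      Ineq191 (dist1 (plaqHol (D.Upp U) p)) (D.dev97 U p) D.α ((D.L ^ j)⁻¹) (D.ε j) (E124 D.ε D.L D.η D.k j))
    (L97 : ∀ U, new189 D U → ∀ j, D.h ≤ j → j ≤ D.k → ∀ p ∈ plaqsOf (dom D j),
      Ineq191 (D.dev97 U p) (D.dev0 U p) D.α ((D.L ^ j)⁻¹) (D.ε j) (E124 D.ε D.L D.η D.k j))
    (L80 : ∀ U, new189 D U → ∀ j, D.h ≤ j → j ≤ D.k → ∀ p ∈ plaqsOf (dom D j),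
      Ineq180 (D.dev0 U p) (D.ε D.k) D.η D.B₃ D.B₅ D.M D.δ (D.dist p) D.O1) :
    B15Leaf (WOfRecord₁₃ F N (Θ.liveRepin₁₃ F N)
      ((lam.pinRPrime₁₃ (Θ.liveRepin₁₃ F N)).pinD189ZH (Θ.liveRepin₁₃ F N).ν (Θ.liveRepin₁₃ F N).A₁ (Θ.liveRepin₁₃ F N).τ9.M
        (gOfRecord₁₃ F N (Θ.liveRepin₁₃ F N))
        (fun P => ((σ P).pinCubes ((σ P).OmTᶜ ∩ omegaOfChain (s P) (lam.kSel P + 1 - Nm P))).pinDistAt (lam.kSel P + 1)) s Nm (fun P => N0OfRecord₁₃ (Θ.liveRepin₁₃ F N) P (lam.kSel P + 1)) enl p₁) P) := by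
  subst hD
  exact b15Leaf_WOfRecord₁₃_liveRepin₁₃_of_massLive_of_hasResiduals Θ _ hres hK rfl hmassLive hP1 (fun U hU i hi hik q hq => L80 U hU i hi hik q hq)
    (claim189_sitOfHist_geom_N0Z_of_flow (Nm P) P (σ P) (s P) p₁ hsh (enl P) henl rfl hlog hNN hNk hβ0 hβ hL₀ hL₀L hB hδ hN₀ hMl hε0 hε1 hβ₀0 hβ₀ hflow
      hgeom L91h L95 L91 L97 L80)

end Leaf

/-! ## §2 AT THE PLAN's `L`-KEYED WITNESS `θ₁₅ᶜ = theta13OfThm1C F N ε₀ ε₂₉ B₃ a₀ a₁`: non-vacuity and N12's cube-pinned term-pinned row with ZERO K0‴-side hypotheses -/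

section Thm1C
variable (ε₀ ε₂₉ B₃ a₀ a₁ : ℝ) (lam : ResidW F N) (σ : ∀ P : B12.RunParams, Sit189 F N P.K)
  (s : ∀ P : B12.RunParams, SeqOfRecord F (theta13OfThm1C F N ε₀ ε₂₉ B₃ a₀ a₁).ν (theta13OfThm1C F N ε₀ ε₂₉ B₃ a₀ a₁).τ9.M
    (gOfRecord₁₃ F N (theta13OfThm1C F N ε₀ ε₂₉ B₃ a₀ a₁) P) P.K (lam.kSel P + 1)) (Nm N₀ : B12.RunParams → ℕ) (p₁ : ℕ)

/-- **NON-VACUITY AT `θ₁₅ᶜ`, ADMISSIBILITY FROM THE FIVE WITNESS SIGNS** (14C's `new189_pinAllTH_liveRepin₁₃_one_zero` at the cube-pinned family, K0a's `admissible_theta13OfThm1C`): on a run whose ₁₃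
history lies in `]0, ½]` up to `n ≥ kSel P + 1`, with residual numbers `0 ≤ β < 1`, `0 < L₀`, `0 ≤ O(1)B₃B₅`, the (1.80) ∕ (1.89) antecedent `new189 (λᶜ.D189 P) (1, 0)` HOLDS — the displays of
`b15Leaf_WOfRecord₁₃_pinAllTHCubes_theta13OfThm1C_of_massLive_of_flow` are not vacuous there. [cite: Balaban1989LargeFieldI, (1.82) p.196, (1.89) p.198; Balaban1988Convergent, (2.4) p.255, (2.10) p.256 (bookkeeping census)] -/
theorem new189_pinAllTHCubes_theta13OfThm1C_one_zero (hε : 0 < ε₀) (hε' : 0 < ε₂₉) (hB : 0 ≤ B₃) (ha₀ : 0 < a₀) (ha₁ : 0 < a₁)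
    (P : B12.RunParams) {n : ℕ} (hI : Step.InInterval (theta13OfThm1C F N ε₀ ε₂₉ B₃ a₀ a₁).γ n (gOfRecord₁₃ F N (theta13OfThm1C F N ε₀ ε₂₉ B₃ a₀ a₁) P))
    (hkn : lam.kSel P + 1 ≤ n) (hβ0 : 0 ≤ (σ P).β) (hβ1 : (σ P).β < 1) (hL₀ : 0 < (σ P).L₀) (hBB : 0 ≤ (σ P).O1 * (σ P).B₃ * (σ P).B₅) :
    new189 (((lam.pinRPrime₁₃ (theta13OfThm1C F N ε₀ ε₂₉ B₃ a₀ a₁)).pinD189TH (theta13OfThm1C F N ε₀ ε₂₉ B₃ a₀ a₁).ν (theta13OfThm1C F N ε₀ ε₂₉ B₃ a₀ a₁).A₁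
        (theta13OfThm1C F N ε₀ ε₂₉ B₃ a₀ a₁).τ9.M (gOfRecord₁₃ F N (theta13OfThm1C F N ε₀ ε₂₉ B₃ a₀ a₁))
        (fun P => (σ P).pinCubes ((σ P).OmTᶜ ∩ omegaOfChain (s P) (lam.kSel P + 1 - Nm P))) s Nm N₀ p₁).D189 P)
      ((1 : MSField (F.P P.K) (SU N)), fun _ _ => (0 : EuclideanSpace ℝ (Fin (N ^ 2 - 1)))) :=
  new189_pinAllTH_liveRepin₁₃_one_zero
    (theta13OfNumerics F N (stage12NumericsOfThm1C F.L ε₀ B₃ a₀ a₁) ε₂₉ (zeta316OfRecord F N (stage12NumericsOfThm1C F.L ε₀ B₃ a₀ a₁).ν (stage12NumericsOfThm1C F.L ε₀ B₃ a₀ a₁).τ9.M (stage12NumericsOfThm1C F.L ε₀ B₃ a₀ a₁).A₁) (RzOfRecord F N) (ZtOfRecord F N))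
    lam (fun P => (σ P).pinCubes ((σ P).OmTᶜ ∩ omegaOfChain (s P) (lam.kSel P + 1 - Nm P))) s Nm N₀ p₁
    (admissible_theta13OfThm1C F N hε hε' hB ha₀ ha₁) P hI hkn hβ0 hβ1 hL₀ hBB

/-- **★★ N12's ROW AT `θ₁₅ᶜ`'s CUBE-PINNED TERM-PINNED BUNDLE OF RECORD `WOfRecord₁₃ θ₁₅ᶜ λᶜ P`, `kSel P < K`, ZERO K0‴-SIDE HYPOTHESES, NO (1.89) DISPLAY** (§1 at
`Θ := theta13OfNumerics … (stage12NumericsOfThm1C …) …`, K0a's `hasResidualsOfRecord_theta13OfNumerics`): displayed exactly the per-run [IV] inputs listed in the header — nothing of `Provisos₁₃`, row P11,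
admissibility or the witness signs. [cite: Balaban1989LargeFieldI, (0.2)–(0.6) p.176, p.176 ll.14–16, Prop. 1 (1.78) p.194, (1.80) p.195, (1.88)–(1.90) pp.197–198, pp.199–201; Balaban1988Convergent, (2.1) p.254, (2.8) p.256, (2.17) p.257, (3.16) p.268, (3.22)–(3.25) pp.269–270; Balaban1985Variational, Thm 1 p.279 (witness letters only)] -/
theorem b15Leaf_WOfRecord₁₃_pinAllTHCubes_theta13OfThm1C_of_massLive_of_flow {P : B12.RunParams} (hK : lam.kSel P < P.K) (hsh : 0 < (σ P).sh)
    {D : Setting189 (F.P P.K) (SU N) (MSField (F.P P.K) (SU N) × ((j : ℕ) → VecField (F.P P.K) j (EuclideanSpace ℝ (Fin (N ^ 2 - 1))))) (Pt (F.P P.K).d)}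
    (hD : D = ((lam.pinRPrime₁₃ (theta13OfThm1C F N ε₀ ε₂₉ B₃ a₀ a₁)).pinD189TH (theta13OfThm1C F N ε₀ ε₂₉ B₃ a₀ a₁).ν (theta13OfThm1C F N ε₀ ε₂₉ B₃ a₀ a₁).A₁ (theta13OfThm1C F N ε₀ ε₂₉ B₃ a₀ a₁).τ9.M
      (gOfRecord₁₃ F N (theta13OfThm1C F N ε₀ ε₂₉ B₃ a₀ a₁))
        (fun P => (σ P).pinCubes ((σ P).OmTᶜ ∩ omegaOfChain (s P) (lam.kSel P + 1 - Nm P))) s Nm N₀ p₁).D189 P)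
    (hmassLive : ∀ a, LiveSeq F N (theta13OfThm1C F N ε₀ ε₂₉ B₃ a₀ a₁).ν (theta13OfThm1C F N ε₀ ε₂₉ B₃ a₀ a₁).τ9 P (gOfRecord₁₃ F N (theta13OfThm1C F N ε₀ ε₂₉ B₃ a₀ a₁) P) (lam.kSel P + 1)
        (slotsTOfRecord F N (theta13OfThm1C F N ε₀ ε₂₉ B₃ a₀ a₁).ν (theta13OfThm1C F N ε₀ ε₂₉ B₃ a₀ a₁).τ9 (EOfRecord₁₃ F N (theta13OfThm1C F N ε₀ ε₂₉ B₃ a₀ a₁)) (wOfRecord₉ F N (theta13OfThm1C F N ε₀ ε₂₉ B₃ a₀ a₁).toStage9Params)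
          (theta13OfThm1C F N ε₀ ε₂₉ B₃ a₀ a₁).ppSel P (gOfRecord₁₃ F N (theta13OfThm1C F N ε₀ ε₂₉ B₃ a₀ a₁) P) (lam.kSel P + 1)) a →
      0 < ∫ V, rterm (reprTOfRecord₁₃ F N (theta13OfThm1C F N ε₀ ε₂₉ B₃ a₀ a₁) P (lam.kSel P)) a V ∂(fieldMeasure (F.P P.K) (lam.kSel P + 1) (SU N)))
    (hP1 : Prop1Printed (lam.LF P))
    -- levels, residual numerics, print's two conditions (p. 200)
    (hN2 : 2 ≤ N₀ P) (hNN : N₀ P ≤ Nm P) (hNk : N₀ P ≤ lam.kSel P + 1)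
    (hβ0 : 0 ≤ (σ P).β) (hβ : (σ P).β ≤ 1 / 4) (hL₀ : 2 ≤ (σ P).L₀) (hL₀L : (σ P).L₀ ^ 2 ≤ ((F.P P.K).L : ℝ))
    (hB : 0 ≤ (σ P).O1 * (σ P).B₃ * (σ P).B₅) (hδ : 0 ≤ (σ P).δ) (hdist : ∀ p, 0 ≤ (σ P).dist p)
    (hN₀ : (2 + (121 / 120) ^ 2 * ((σ P).O1 * (σ P).B₃ * (σ P).B₅ * ((theta13OfThm1C F N ε₀ ε₂₉ B₃ a₀ a₁).τ9.M : ℝ) ^ 5)) * ((((σ P).L₀ ^ 2) ^ (N₀ P - 1))⁻¹) ≤ 1 / 4)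
    (hMl : (121 / 120) ^ 2 * ((σ P).O1 * (σ P).B₃ * (σ P).B₅ * ((theta13OfThm1C F N ε₀ ε₂₉ B₃ a₀ a₁).τ9.M : ℝ) ^ 5) * Real.exp (-(4 * (σ P).δ * ((theta13OfThm1C F N ε₀ ε₂₉ B₃ a₀ a₁).τ9.M : ℝ))) ≤ 1 / 12)
    -- the flow inputs along the Stage-13 history (window-free)
    (hε0 : ∀ i, lam.kSel P + 1 - Nm P ≤ i → i ≤ lam.kSel P + 1 → 0 ≤ epsOfRecord (theta13OfThm1C F N ε₀ ε₂₉ B₃ a₀ a₁).ν (gOfRecord₁₃ F N (theta13OfThm1C F N ε₀ ε₂₉ B₃ a₀ a₁) P) i)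
    (hε1 : ∀ i, lam.kSel P + 1 - Nm P ≤ i → i ≤ lam.kSel P + 1 → epsOfRecord (theta13OfThm1C F N ε₀ ε₂₉ B₃ a₀ a₁).ν (gOfRecord₁₃ F N (theta13OfThm1C F N ε₀ ε₂₉ B₃ a₀ a₁) P) i ≤ 1 / 10)
    {β₀ : ℝ} (hβ₀0 : 0 ≤ β₀) (hβ₀ : β₀ ≤ 1 / 2)
    (hflow : ∀ j, lam.kSel P + 1 - Nm P ≤ j → j < lam.kSel P + 1 → epsOfRecord (theta13OfThm1C F N ε₀ ε₂₉ B₃ a₀ a₁).ν (gOfRecord₁₃ F N (theta13OfThm1C F N ε₀ ε₂₉ B₃ a₀ a₁) P) (lam.kSel P + 1)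
      ≤ (1 + β₀) * Real.sqrt ((lam.kSel P + 1 - j : ℕ) : ℝ) * epsOfRecord (theta13OfThm1C F N ε₀ ε₂₉ B₃ a₀ a₁).ν (gOfRecord₁₃ F N (theta13OfThm1C F N ε₀ ε₂₉ B₃ a₀ a₁) P) j)
    -- located geometry
    (hZk : ∀ m, lam.kSel P + 1 - N₀ P < m → m < lam.kSel P + 1 → (σ P).Zpp (lam.kSel P + 1) ∩ omegaOfChain (s P) m ⊆ omegaOfChain (s P) (m + 1))
    (hgeom : ∀ m, D.k₀ < m → m < D.k → ∀ p ∈ plaqsOf (D.Ω m \ D.Ω (m + 1)), 4 * ((m : ℝ) - D.k₀) * D.M ≤ D.dist p)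
    -- the four ℍ-leaves and (1.80)
    (L91h : ∀ U, new189 D U → ∀ p ∈ plaqsOf (half D),
      Ineq191 (dist1 (plaqHol (D.Upp U) p)) (D.devV'' U p) D.α ((D.L ^ D.h)⁻¹) (D.ε D.h) (E124 D.ε D.L D.η D.k D.h))
    (L95 : ∀ U, new189 D U → ∀ p ∈ plaqsOf (half D),
      Ineq195 (D.devV'' U p) (dist1 (plaqHol (D.Uhalf U (D.boxOf p)) p)) D.α ((D.L ^ D.h)⁻¹) (D.ε D.h) (E124 D.ε D.L D.η D.k D.h))
    (L91 : ∀ U, new189 D U → ∀ j, D.h ≤ j → j ≤ D.k → ∀ p ∈ plaqsOf (dom D j),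
      Ineq191 (dist1 (plaqHol (D.Upp U) p)) (D.dev97 U p) D.α ((D.L ^ j)⁻¹) (D.ε j) (E124 D.ε D.L D.η D.k j))
    (L97 : ∀ U, new189 D U → ∀ j, D.h ≤ j → j ≤ D.k → ∀ p ∈ plaqsOf (dom D j),
      Ineq191 (D.dev97 U p) (D.dev0 U p) D.α ((D.L ^ j)⁻¹) (D.ε j) (E124 D.ε D.L D.η D.k j))
    (L80 : ∀ U, new189 D U → ∀ j, D.h ≤ j → j ≤ D.k → ∀ p ∈ plaqsOf (dom D j),
      Ineq180 (D.dev0 U p) (D.ε D.k) D.η D.B₃ D.B₅ D.M D.δ (D.dist p) D.O1) :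
    B15Leaf (WOfRecord₁₃ F N (theta13OfThm1C F N ε₀ ε₂₉ B₃ a₀ a₁)
      ((lam.pinRPrime₁₃ (theta13OfThm1C F N ε₀ ε₂₉ B₃ a₀ a₁)).pinD189TH (theta13OfThm1C F N ε₀ ε₂₉ B₃ a₀ a₁).ν (theta13OfThm1C F N ε₀ ε₂₉ B₃ a₀ a₁).A₁ (theta13OfThm1C F N ε₀ ε₂₉ B₃ a₀ a₁).τ9.M
        (gOfRecord₁₃ F N (theta13OfThm1C F N ε₀ ε₂₉ B₃ a₀ a₁))
        (fun P => (σ P).pinCubes ((σ P).OmTᶜ ∩ omegaOfChain (s P) (lam.kSel P + 1 - Nm P))) s Nm N₀ p₁) P) :=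
  b15Leaf_WOfRecord₁₃_pinAllTHCubes_liveRepin₁₃_of_massLive_of_hasResiduals_of_flow
    (theta13OfNumerics F N (stage12NumericsOfThm1C F.L ε₀ B₃ a₀ a₁) ε₂₉ (zeta316OfRecord F N (stage12NumericsOfThm1C F.L ε₀ B₃ a₀ a₁).ν (stage12NumericsOfThm1C F.L ε₀ B₃ a₀ a₁).τ9.M (stage12NumericsOfThm1C F.L ε₀ B₃ a₀ a₁).A₁) (RzOfRecord F N) (ZtOfRecord F N)) lam σ s Nm N₀ p₁
    (hasResidualsOfRecord_theta13OfNumerics F N (stage12NumericsOfThm1C F.L ε₀ B₃ a₀ a₁) ε₂₉) hK hsh hD hmassLive hP1 hN2 hNN hNk hβ0 hβ hL₀ hL₀L hB hδ hdist hN₀ hMl hε0 hε1 hβ₀0 hβ₀ hflow hZk hgeom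
    L91h L95 L91 L97 L80


/-- **★★★ N12's MOST-PINNED ROW AT `θ₁₅ᶜ`: the cube-, distance-, `Z″`- and `N₀`-pinned term-pinned bundle of record `WOfRecord₁₃ θ₁₅ᶜ λᵍ P`, `kSel P < K` — ZERO K0‴-SIDE HYPOTHESES, NO (1.89)
DISPLAY, NO located input except the shell bound** (§1's geom row at `Θ := theta13OfNumerics … (stage12NumericsOfThm1C …) …`).  THE KERNEL's LIST OF WHAT N12 COSTS PER RUN AT THE PLAN's WITNESS =
this hypothesis list: live-mass at level `kSel P + 1`; Prop. 1 at `λ.LF P`; `1 < (log g_{k′}⁻²)^r`, `N₀ ≤ N P`, `N₀ ≤ k′`; the situation's residual numbers `0 ≤ β ≤ ¼`, `2 ≤ L₀`, `L₀² ≤ L`,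
`0 ≤ O(1)B₃B₅`, `0 ≤ δ`, `0 < sh` with print's two p.200 conditions; the flow inputs `hε0 ∕ hε1 ∕ hflow` along the ₁₃ history; the shell bound `hgeom`; the four ℍ-leaves and (1.80) at the pinned
letters. [cite: Balaban1989LargeFieldI, (0.2)–(0.6) p.176, p.176 ll.14–16, Prop. 1 (1.78) p.194, (1.80) p.195, (1.10)–(1.11) p.179, (1.88)–(1.90) pp.197–198, pp.199–201; Balaban1988Convergent, (2.1) p.254, (2.5)–(2.8) pp.255–256, (2.17) p.257, (3.16) p.268, (3.22)–(3.25) pp.269–270; Balaban1985Variational, Thm 1 p.279 (witness letters only)] -/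
theorem b15Leaf_WOfRecord₁₃_pinAllGeom_N0_theta13OfThm1C_of_massLive_of_flow
    (enl : ∀ P : B12.RunParams, ℕ → ℕ → Set (Site (F.P P.K) 0) → Set (Site (F.P P.K) 0)) {P : B12.RunParams} (hK : lam.kSel P < P.K) (hsh : 0 < (σ P).sh)
    (henl : ∀ n j (S : Set (Site (F.P P.K) 0)), S ⊆ enl P n j S)
    {D : Setting189 (F.P P.K) (SU N) (MSField (F.P P.K) (SU N) × ((j : ℕ) → VecField (F.P P.K) j (EuclideanSpace ℝ (Fin (N ^ 2 - 1))))) (Pt (F.P P.K).d)}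
    (hD : D = ((lam.pinRPrime₁₃ (theta13OfThm1C F N ε₀ ε₂₉ B₃ a₀ a₁)).pinD189ZH (theta13OfThm1C F N ε₀ ε₂₉ B₃ a₀ a₁).ν (theta13OfThm1C F N ε₀ ε₂₉ B₃ a₀ a₁).A₁ (theta13OfThm1C F N ε₀ ε₂₉ B₃ a₀ a₁).τ9.M
      (gOfRecord₁₃ F N (theta13OfThm1C F N ε₀ ε₂₉ B₃ a₀ a₁))
        (fun P => ((σ P).pinCubes ((σ P).OmTᶜ ∩ omegaOfChain (s P) (lam.kSel P + 1 - Nm P))).pinDistAt (lam.kSel P + 1)) s Nm (fun P => N0OfRecord₁₃ (theta13OfThm1C F N ε₀ ε₂₉ B₃ a₀ a₁) P (lam.kSel P + 1)) enl p₁).D189 P)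
    (hmassLive : ∀ a, LiveSeq F N (theta13OfThm1C F N ε₀ ε₂₉ B₃ a₀ a₁).ν (theta13OfThm1C F N ε₀ ε₂₉ B₃ a₀ a₁).τ9 P (gOfRecord₁₃ F N (theta13OfThm1C F N ε₀ ε₂₉ B₃ a₀ a₁) P) (lam.kSel P + 1)
        (slotsTOfRecord F N (theta13OfThm1C F N ε₀ ε₂₉ B₃ a₀ a₁).ν (theta13OfThm1C F N ε₀ ε₂₉ B₃ a₀ a₁).τ9 (EOfRecord₁₃ F N (theta13OfThm1C F N ε₀ ε₂₉ B₃ a₀ a₁)) (wOfRecord₉ F N (theta13OfThm1C F N ε₀ ε₂₉ B₃ a₀ a₁).toStage9Params)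
          (theta13OfThm1C F N ε₀ ε₂₉ B₃ a₀ a₁).ppSel P (gOfRecord₁₃ F N (theta13OfThm1C F N ε₀ ε₂₉ B₃ a₀ a₁) P) (lam.kSel P + 1)) a →
      0 < ∫ V, rterm (reprTOfRecord₁₃ F N (theta13OfThm1C F N ε₀ ε₂₉ B₃ a₀ a₁) P (lam.kSel P)) a V ∂(fieldMeasure (F.P P.K) (lam.kSel P + 1) (SU N)))
    (hP1 : Prop1Printed (lam.LF P))
    (hlog : 1 < (Real.log (gOfRecord₁₃ F N (theta13OfThm1C F N ε₀ ε₂₉ B₃ a₀ a₁) P (lam.kSel P + 1) ^ 2)⁻¹) ^ (theta13OfThm1C F N ε₀ ε₂₉ B₃ a₀ a₁).ν.r)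
    (hNN : N0OfRecord₁₃ (theta13OfThm1C F N ε₀ ε₂₉ B₃ a₀ a₁) P (lam.kSel P + 1) ≤ Nm P) (hNk : N0OfRecord₁₃ (theta13OfThm1C F N ε₀ ε₂₉ B₃ a₀ a₁) P (lam.kSel P + 1) ≤ lam.kSel P + 1)
    (hβ0 : 0 ≤ (σ P).β) (hβ : (σ P).β ≤ 1 / 4) (hL₀ : 2 ≤ (σ P).L₀) (hL₀L : (σ P).L₀ ^ 2 ≤ ((F.P P.K).L : ℝ))
    (hB : 0 ≤ (σ P).O1 * (σ P).B₃ * (σ P).B₅) (hδ : 0 ≤ (σ P).δ)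
    (hN₀ : (2 + (121 / 120) ^ 2 * ((σ P).O1 * (σ P).B₃ * (σ P).B₅ * ((theta13OfThm1C F N ε₀ ε₂₉ B₃ a₀ a₁).τ9.M : ℝ) ^ 5)) *
      ((((σ P).L₀ ^ 2) ^ (N0OfRecord₁₃ (theta13OfThm1C F N ε₀ ε₂₉ B₃ a₀ a₁) P (lam.kSel P + 1) - 1))⁻¹) ≤ 1 / 4)
    (hMl : (121 / 120) ^ 2 * ((σ P).O1 * (σ P).B₃ * (σ P).B₅ * ((theta13OfThm1C F N ε₀ ε₂₉ B₃ a₀ a₁).τ9.M : ℝ) ^ 5) * Real.exp (-(4 * (σ P).δ * ((theta13OfThm1C F N ε₀ ε₂₉ B₃ a₀ a₁).τ9.M : ℝ))) ≤ 1 / 12)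
    (hε0 : ∀ i, lam.kSel P + 1 - Nm P ≤ i → i ≤ lam.kSel P + 1 → 0 ≤ epsOfRecord (theta13OfThm1C F N ε₀ ε₂₉ B₃ a₀ a₁).ν (gOfRecord₁₃ F N (theta13OfThm1C F N ε₀ ε₂₉ B₃ a₀ a₁) P) i)
    (hε1 : ∀ i, lam.kSel P + 1 - Nm P ≤ i → i ≤ lam.kSel P + 1 → epsOfRecord (theta13OfThm1C F N ε₀ ε₂₉ B₃ a₀ a₁).ν (gOfRecord₁₃ F N (theta13OfThm1C F N ε₀ ε₂₉ B₃ a₀ a₁) P) i ≤ 1 / 10)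
    {β₀ : ℝ} (hβ₀0 : 0 ≤ β₀) (hβ₀ : β₀ ≤ 1 / 2)
    (hflow : ∀ j, lam.kSel P + 1 - Nm P ≤ j → j < lam.kSel P + 1 → epsOfRecord (theta13OfThm1C F N ε₀ ε₂₉ B₃ a₀ a₁).ν (gOfRecord₁₃ F N (theta13OfThm1C F N ε₀ ε₂₉ B₃ a₀ a₁) P) (lam.kSel P + 1)
      ≤ (1 + β₀) * Real.sqrt ((lam.kSel P + 1 - j : ℕ) : ℝ) * epsOfRecord (theta13OfThm1C F N ε₀ ε₂₉ B₃ a₀ a₁).ν (gOfRecord₁₃ F N (theta13OfThm1C F N ε₀ ε₂₉ B₃ a₀ a₁) P) j)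
    (hgeom : ∀ m, D.k₀ < m → m < D.k → ∀ p ∈ plaqsOf (D.Ω m \ D.Ω (m + 1)), 4 * ((m : ℝ) - D.k₀) * D.M ≤ D.dist p)
    (L91h : ∀ U, new189 D U → ∀ p ∈ plaqsOf (half D),
      Ineq191 (dist1 (plaqHol (D.Upp U) p)) (D.devV'' U p) D.α ((D.L ^ D.h)⁻¹) (D.ε D.h) (E124 D.ε D.L D.η D.k D.h))
    (L95 : ∀ U, new189 D U → ∀ p ∈ plaqsOf (half D),
      Ineq195 (D.devV'' U p) (dist1 (plaqHol (D.Uhalf U (D.boxOf p)) p)) D.α ((D.L ^ D.h)⁻¹) (D.ε D.h) (E124 D.ε D.L D.η D.k D.h))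
    (L91 : ∀ U, new189 D U → ∀ j, D.h ≤ j → j ≤ D.k → ∀ p ∈ plaqsOf (dom D j),
      Ineq191 (dist1 (plaqHol (D.Upp U) p)) (D.dev97 U p) D.α ((D.L ^ j)⁻¹) (D.ε j) (E124 D.ε D.L D.η D.k j))
    (L97 : ∀ U, new189 D U → ∀ j, D.h ≤ j → j ≤ D.k → ∀ p ∈ plaqsOf (dom D j),
      Ineq191 (D.dev97 U p) (D.dev0 U p) D.α ((D.L ^ j)⁻¹) (D.ε j) (E124 D.ε D.L D.η D.k j))
    (L80 : ∀ U, new189 D U → ∀ j, D.h ≤ j → j ≤ D.k → ∀ p ∈ plaqsOf (dom D j),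
      Ineq180 (D.dev0 U p) (D.ε D.k) D.η D.B₃ D.B₅ D.M D.δ (D.dist p) D.O1) :
    B15Leaf (WOfRecord₁₃ F N (theta13OfThm1C F N ε₀ ε₂₉ B₃ a₀ a₁)
      ((lam.pinRPrime₁₃ (theta13OfThm1C F N ε₀ ε₂₉ B₃ a₀ a₁)).pinD189ZH (theta13OfThm1C F N ε₀ ε₂₉ B₃ a₀ a₁).ν (theta13OfThm1C F N ε₀ ε₂₉ B₃ a₀ a₁).A₁ (theta13OfThm1C F N ε₀ ε₂₉ B₃ a₀ a₁).τ9.M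
        (gOfRecord₁₃ F N (theta13OfThm1C F N ε₀ ε₂₉ B₃ a₀ a₁))
        (fun P => ((σ P).pinCubes ((σ P).OmTᶜ ∩ omegaOfChain (s P) (lam.kSel P + 1 - Nm P))).pinDistAt (lam.kSel P + 1)) s Nm (fun P => N0OfRecord₁₃ (theta13OfThm1C F N ε₀ ε₂₉ B₃ a₀ a₁) P (lam.kSel P + 1)) enl p₁) P) :=
  b15Leaf_WOfRecord₁₃_pinAllGeom_N0_liveRepin₁₃_of_massLive_of_hasResiduals_of_flow
    (theta13OfNumerics F N (stage12NumericsOfThm1C F.L ε₀ B₃ a₀ a₁) ε₂₉ (zeta316OfRecord F N (stage12NumericsOfThm1C F.L ε₀ B₃ a₀ a₁).ν (stage12NumericsOfThm1C F.L ε₀ B₃ a₀ a₁).τ9.M (stage12NumericsOfThm1C F.L ε₀ B₃ a₀ a₁).A₁) (RzOfRecord F N) (ZtOfRecord F N)) lam σ s Nm p₁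
    (hasResidualsOfRecord_theta13OfNumerics F N (stage12NumericsOfThm1C F.L ε₀ B₃ a₀ a₁) ε₂₉) enl hK hsh henl hD hmassLive hP1 hlog hNN hNk hβ0 hβ hL₀ hL₀L hB hδ hN₀ hMl hε0 hε1 hβ₀0 hβ₀ hflow
    hgeom L91h L95 L91 L97 L80

end Thm1C

end Summit.QuantumFields.YangMills.BalabanUVNodes.N12AtRecord13TermPinnedCubes
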